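import Summits.Ventures.LatticeQCDFlow.Scoring.U1TorusPlaquetteBounds
import HarnessLib

/-!
# Central terms and tails of the second-moment sums of the 2-d `U(1)` torus plaquette

HONEST FRAMING: exact (Metropolis-corrected) sampling algorithms for lattice gauge theory;
figures of merit are autocorrelation/cost numbers at stated couplings and volumes; no
continuum-physics claim.

Venture `LatticeQCDFlow` (cell pub-lqcd), sub-topic `Scoring`; FANOUT row 5 (`s0-sun-a`), GEN-13.
NEW WORK of the cell (placement rule).  `Scoring/U1TorusPlaquettePair.lean` and
`Scoring/U1TorusPlaquetteAverageVariance.lean` (GEN-13) express the exact variance of the volume-averaged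
plaquette of the `L₁ × L₂` torus through the four series `Z = Σ_k I_{|k|}^V`,
`N = Σ_k I_{|k|}^{V−1} I_k'`, `P = Σ_k I_{|k|}^{V−2} (I_k')²`, `S = Σ_k I_{|k|}^{V−1} I_k''`
(`I_k' = (I_{|k−1|}+I_{|k+1|})/2`, `I_k'' = (I_{|k−2|}+2I_{|k|}+I_{|k+2|})/4`).  As
`Scoring/U1TorusPlaquetteBounds.lean` (GEN-8) did for `Z` and `N`, this file prepares kernel enclosures of
`P` and `S` (`β > 0`):

* §1 a generic tail lemma over the charges `|k| ≥ 3` (`torus_tail_le`: `f_k ≤ C·I_{|k|}` off the five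
  central charges gives `0 ≤ Σ_{|k|≥3} f_k ≤ C e^β`), the bounds `I_k' ≤ I₀`, `I_k'' ≤ I₀`;
* §2 summability of the `P`- and `S`-summands, their TAILS
  `Σ_{|k|≥3} I_{|k|}^{V−2}(I_k')² ≤ max(I₃,I₄)^{V−3} I₀² e^β` (`V ≥ 3`),
  `Σ_{|k|≥3} I_{|k|}^{V−1} I_k'' ≤ max(I₃,I₄)^{V−2} I₀ e^β` (`V ≥ 2`), and their CENTRAL TERMS in closed form
  `P: I₀^{V−2}I₁² + 2I₁^{V−2}((I₀+I₂)/2)² + 2I₂^{V−2}((I₁+I₃)/2)²`,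
  `S: I₀^{V−1}(I₀+I₂)/2 + 2I₁^{V−1}(3I₁+I₃)/4 + 2I₂^{V−1}(I₀+2I₂+I₄)/4`.

The certificate checker and the enclosures at the S0-B keys are the companion files.  Elementary;
nothing is cited; no `def`.
-/

noncomputable section

open Real Finset
open scoped Nat
open Literature.Analysis.FunctionSpaces

namespace Summit.Ventures.LatticeQCDFlow.Scoring

/-! ### 1. A generic tail lemma and bounds for `I_k'`, `I_k''` -/

/-- **Generic tail bound**: a non-negative summable `f : ℤ → ℝ` with `f_k ≤ C·I_{|k|}(β)` off the five
central charges has `0 ≤ Σ_{|k|≥3} f_k ≤ C·e^β` (`Σ_{k∈ℤ} I_{|k|}(β) = e^β`). -/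
theorem torus_tail_le {β : ℝ} (hβ : 0 < β) {f : ℤ → ℝ} (hf0 : ∀ k, 0 ≤ f k) (hfs : Summable f)
    {C : ℝ} (hC : 0 ≤ C) (hle : ∀ k : ℤ, k ∉ centralCharges → f k ≤ C * besselI k.natAbs β) :
    0 ≤ ∑' k : {k : ℤ // k ∉ centralCharges}, f k.1 ∧
      ∑' k : {k : ℤ // k ∉ centralCharges}, f k.1 ≤ C * Real.exp β := by
  refine ⟨tsum_nonneg fun k => hf0 k.1, ?_⟩
  have hS1 : Summable fun k : {k : ℤ // k ∉ centralCharges} => C * besselI k.1.natAbs β :=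
    ((summable_besselI_natAbs β).mul_left C).subtype _
  calc ∑' k : {k : ℤ // k ∉ centralCharges}, f k.1
      ≤ ∑' k : {k : ℤ // k ∉ centralCharges}, C * besselI k.1.natAbs β :=
        (hfs.subtype _).tsum_le_tsum (fun k => hle k.1 k.2) hS1
    _ = C * ∑' k : {k : ℤ // k ∉ centralCharges}, besselI k.1.natAbs β := tsum_mul_left
    _ ≤ C * ∑' k : ℤ, besselI k.natAbs β := by
        refine mul_le_mul_of_nonneg_left ?_ hC
        exact (summable_besselI_natAbs β).tsum_subtype_le (fun k : ℤ => besselI k.natAbs β)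
          {k : ℤ | k ∉ centralCharges} (fun k => (besselI_pos _ hβ).le)
    _ = C * Real.exp β := by rw [(hasSum_besselI_natAbs β).tsum_eq]

/-- `0 ≤ I_k' = (I_{|k−1|}+I_{|k+1|})/2 ≤ I₀` for `β > 0`. -/
theorem torusJ_mem {β : ℝ} (hβ : 0 < β) (k : ℤ) :
    0 ≤ (besselI (k - 1).natAbs β + besselI (k + 1).natAbs β) / 2 ∧
      (besselI (k - 1).natAbs β + besselI (k + 1).natAbs β) / 2 ≤ besselI 0 β := by
  have h1 := (besselI_pos (k - 1).natAbs hβ).le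
  have h2 := (besselI_pos (k + 1).natAbs hβ).le
  have h3 := besselI_le_besselI_zero (k - 1).natAbs β
  have h4 := besselI_le_besselI_zero (k + 1).natAbs β
  constructor
  · positivity
  · linarith

/-- `0 ≤ I_k'' = (I_{|k−2|}+2I_{|k|}+I_{|k+2|})/4 ≤ I₀` for `β > 0`. -/
theorem torusQ_mem {β : ℝ} (hβ : 0 < β) (k : ℤ) :
    0 ≤ (besselI (k - 2).natAbs β + 2 * besselI k.natAbs β + besselI (k + 2).natAbs β) / 4 ∧
      (besselI (k - 2).natAbs β + 2 * besselI k.natAbs β + besselI (k + 2).natAbs β) / 4 ≤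
        besselI 0 β := by
  have h1 := (besselI_pos (k - 2).natAbs hβ).le
  have h2 := (besselI_pos (k + 2).natAbs hβ).le
  have h0 := (besselI_pos k.natAbs hβ).le
  have h3 := besselI_le_besselI_zero (k - 2).natAbs β
  have h4 := besselI_le_besselI_zero (k + 2).natAbs β
  have h5 := besselI_le_besselI_zero k.natAbs β
  constructor
  · positivity
  · linarith

/-! ### 2. The `P`- and `S`-sums: summability, tails, central terms -/

/-- The `P`-summand `I_{|k|}^{V−2}(I_k')²` is summable over `ℤ` (`V ≥ 3`). -/
theorem summable_torusP_term {β : ℝ} (hβ : 0 < β) {V : ℕ} (hV : 3 ≤ V) :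
    Summable fun k : ℤ => besselI k.natAbs β ^ (V - 2) *
      ((besselI (k - 1).natAbs β + besselI (k + 1).natAbs β) / 2) ^ 2 := by
  obtain ⟨W, rfl⟩ := Nat.exists_eq_add_of_le' hV
  have hI0 := (besselI_pos 0 hβ).le
  refine Summable.of_nonneg_of_le (fun k => ?_) (fun k => ?_)
    ((summable_besselI_natAbs β).mul_left (besselI 0 β ^ W * besselI 0 β ^ 2))
  · have := (besselI_pos k.natAbs hβ).le
    have := (torusJ_mem hβ k).1
    positivity
  · rw [show W + 3 - 2 = W + 1 by omega, pow_succ]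
    obtain ⟨hJ0, hJ1⟩ := torusJ_mem hβ k
    have h1 : besselI k.natAbs β ^ W ≤ besselI 0 β ^ W :=
      pow_le_pow_left₀ (besselI_pos _ hβ).le (besselI_le_besselI_zero _ β) W
    have h2 : ((besselI (k - 1).natAbs β + besselI (k + 1).natAbs β) / 2) ^ 2 ≤ besselI 0 β ^ 2 :=
      pow_le_pow_left₀ hJ0 hJ1 2
    have h3 := (besselI_pos k.natAbs hβ).le
    calc besselI k.natAbs β ^ W * besselI k.natAbs β *
          ((besselI (k - 1).natAbs β + besselI (k + 1).natAbs β) / 2) ^ 2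
        ≤ besselI 0 β ^ W * besselI k.natAbs β * besselI 0 β ^ 2 :=
          mul_le_mul (mul_le_mul_of_nonneg_right h1 h3) h2 (by positivity) (by positivity)
      _ = besselI 0 β ^ W * besselI 0 β ^ 2 * besselI k.natAbs β := by ring

/-- The `S`-summand `I_{|k|}^{V−1} I_k''` is summable over `ℤ` (`V ≥ 2`). -/
theorem summable_torusS_term {β : ℝ} (hβ : 0 < β) {V : ℕ} (hV : 2 ≤ V) :
    Summable fun k : ℤ => besselI k.natAbs β ^ (V - 1) *
      ((besselI (k - 2).natAbs β + 2 * besselI k.natAbs β + besselI (k + 2).natAbs β) / 4) := by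
  obtain ⟨W, rfl⟩ := Nat.exists_eq_add_of_le' hV
  have hI0 := (besselI_pos 0 hβ).le
  refine Summable.of_nonneg_of_le (fun k => ?_) (fun k => ?_)
    ((summable_besselI_natAbs β).mul_left (besselI 0 β ^ W * besselI 0 β))
  · have := (besselI_pos k.natAbs hβ).le
    have := (torusQ_mem hβ k).1
    positivity
  · rw [show W + 2 - 1 = W + 1 by omega, pow_succ]
    obtain ⟨hQ0, hQ1⟩ := torusQ_mem hβ k
    have h1 : besselI k.natAbs β ^ W ≤ besselI 0 β ^ W :=
      pow_le_pow_left₀ (besselI_pos _ hβ).le (besselI_le_besselI_zero _ β) W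
    have h3 := (besselI_pos k.natAbs hβ).le
    calc besselI k.natAbs β ^ W * besselI k.natAbs β *
          ((besselI (k - 2).natAbs β + 2 * besselI k.natAbs β + besselI (k + 2).natAbs β) / 4)
        ≤ besselI 0 β ^ W * besselI k.natAbs β * besselI 0 β :=
          mul_le_mul (mul_le_mul_of_nonneg_right h1 h3) hQ1 hQ0 (by positivity)
      _ = besselI 0 β ^ W * besselI 0 β * besselI k.natAbs β := by ring

/-- **Tail bound for `P`**: `0 ≤ Σ_{|k|≥3} I_{|k|}^{V−2}(I_k')² ≤ max(I₃,I₄)^{V−3} I₀² e^β` (`V ≥ 3`). -/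
theorem torusP_tail_bounds {β : ℝ} (hβ : 0 < β) {V : ℕ} (hV : 3 ≤ V) :
    0 ≤ ∑' k : {k : ℤ // k ∉ centralCharges}, besselI k.1.natAbs β ^ (V - 2) *
        ((besselI (k.1 - 1).natAbs β + besselI (k.1 + 1).natAbs β) / 2) ^ 2 ∧
    ∑' k : {k : ℤ // k ∉ centralCharges}, besselI k.1.natAbs β ^ (V - 2) *
        ((besselI (k.1 - 1).natAbs β + besselI (k.1 + 1).natAbs β) / 2) ^ 2 ≤
      max (besselI 3 β) (besselI 4 β) ^ (V - 3) * besselI 0 β ^ 2 * Real.exp β := by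
  obtain ⟨W, rfl⟩ := Nat.exists_eq_add_of_le' hV
  set m := max (besselI 3 β) (besselI 4 β) with hm
  have hm0 : 0 ≤ m := (besselI_pos 3 hβ).le.trans (le_max_left _ _)
  rw [show W + 3 - 3 = W from rfl]
  refine torus_tail_le hβ (f := fun k : ℤ => besselI k.natAbs β ^ (W + 3 - 2) *
      ((besselI (k - 1).natAbs β + besselI (k + 1).natAbs β) / 2) ^ 2)
    (fun k => by
      have := (besselI_pos k.natAbs hβ).le
      have := (torusJ_mem hβ k).1
      positivity)
    (summable_torusP_term hβ (by omega)) (by positivity) fun k hk => ?_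
  obtain ⟨hJ0, hJ1⟩ := torusJ_mem hβ k
  rw [show W + 3 - 2 = W + 1 from rfl, pow_succ]
  have h1 : besselI k.natAbs β ^ W ≤ m ^ W :=
    pow_le_pow_left₀ (besselI_pos _ hβ).le
      (besselI_le_max_three_four hβ (three_le_natAbs_of_not_mem hk)) W
  have h2 : ((besselI (k - 1).natAbs β + besselI (k + 1).natAbs β) / 2) ^ 2 ≤ besselI 0 β ^ 2 :=
    pow_le_pow_left₀ hJ0 hJ1 2
  have h3 := (besselI_pos k.natAbs hβ).le
  calc besselI k.natAbs β ^ W * besselI k.natAbs β *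
        ((besselI (k - 1).natAbs β + besselI (k + 1).natAbs β) / 2) ^ 2
      ≤ m ^ W * besselI k.natAbs β * besselI 0 β ^ 2 :=
        mul_le_mul (mul_le_mul_of_nonneg_right h1 h3) h2 (by positivity) (by positivity)
    _ = m ^ W * besselI 0 β ^ 2 * besselI k.natAbs β := by ring

/-- **Tail bound for `S`**: `0 ≤ Σ_{|k|≥3} I_{|k|}^{V−1} I_k'' ≤ max(I₃,I₄)^{V−2} I₀ e^β` (`V ≥ 2`). -/
theorem torusS_tail_bounds {β : ℝ} (hβ : 0 < β) {V : ℕ} (hV : 2 ≤ V) :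
    0 ≤ ∑' k : {k : ℤ // k ∉ centralCharges}, besselI k.1.natAbs β ^ (V - 1) *
        ((besselI (k.1 - 2).natAbs β + 2 * besselI k.1.natAbs β + besselI (k.1 + 2).natAbs β) / 4) ∧
    ∑' k : {k : ℤ // k ∉ centralCharges}, besselI k.1.natAbs β ^ (V - 1) *
        ((besselI (k.1 - 2).natAbs β + 2 * besselI k.1.natAbs β + besselI (k.1 + 2).natAbs β) / 4) ≤
      max (besselI 3 β) (besselI 4 β) ^ (V - 2) * besselI 0 β * Real.exp β := by
  obtain ⟨W, rfl⟩ := Nat.exists_eq_add_of_le' hV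
  set m := max (besselI 3 β) (besselI 4 β) with hm
  have hm0 : 0 ≤ m := (besselI_pos 3 hβ).le.trans (le_max_left _ _)
  rw [show W + 2 - 2 = W from rfl]
  refine torus_tail_le hβ (f := fun k : ℤ => besselI k.natAbs β ^ (W + 2 - 1) *
      ((besselI (k - 2).natAbs β + 2 * besselI k.natAbs β + besselI (k + 2).natAbs β) / 4))
    (fun k => by
      have := (besselI_pos k.natAbs hβ).le
      have := (torusQ_mem hβ k).1
      positivity)
    (summable_torusS_term hβ (by omega)) (mul_nonneg (pow_nonneg hm0 W) (besselI_pos 0 hβ).le)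
    fun k hk => ?_
  obtain ⟨hQ0, hQ1⟩ := torusQ_mem hβ k
  rw [show W + 2 - 1 = W + 1 from rfl, pow_succ]
  have h1 : besselI k.natAbs β ^ W ≤ m ^ W :=
    pow_le_pow_left₀ (besselI_pos _ hβ).le
      (besselI_le_max_three_four hβ (three_le_natAbs_of_not_mem hk)) W
  have h3 := (besselI_pos k.natAbs hβ).le
  calc besselI k.natAbs β ^ W * besselI k.natAbs β *
        ((besselI (k - 2).natAbs β + 2 * besselI k.natAbs β + besselI (k + 2).natAbs β) / 4)
      ≤ m ^ W * besselI k.natAbs β * besselI 0 β :=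
        mul_le_mul (mul_le_mul_of_nonneg_right h1 h3) hQ1 hQ0 (by positivity)
    _ = m ^ W * besselI 0 β * besselI k.natAbs β := by ring

/-- **The central terms of `P`**:
`Σ_{|k|≤2} I_{|k|}^{V−2}(I_k')² = I₀^{V−2}I₁² + 2I₁^{V−2}((I₀+I₂)/2)² + 2I₂^{V−2}((I₁+I₃)/2)²`. -/
theorem torusP_central (β : ℝ) (V : ℕ) :
    ∑ k ∈ centralCharges, besselI k.natAbs β ^ (V - 2) *
        ((besselI (k - 1).natAbs β + besselI (k + 1).natAbs β) / 2) ^ 2 =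
      besselI 0 β ^ (V - 2) * besselI 1 β ^ 2 +
        2 * (besselI 1 β ^ (V - 2) * ((besselI 0 β + besselI 2 β) / 2) ^ 2) +
        2 * (besselI 2 β ^ (V - 2) * ((besselI 1 β + besselI 3 β) / 2) ^ 2) := by
  simp only [centralCharges]
  norm_num
  ring

/-- **The central terms of `S`**:
`Σ_{|k|≤2} I_{|k|}^{V−1} I_k'' = I₀^{V−1}(I₀+I₂)/2 + 2I₁^{V−1}(3I₁+I₃)/4 + 2I₂^{V−1}(I₀+2I₂+I₄)/4`. -/
theorem torusS_central (β : ℝ) (V : ℕ) :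
    ∑ k ∈ centralCharges, besselI k.natAbs β ^ (V - 1) *
        ((besselI (k - 2).natAbs β + 2 * besselI k.natAbs β + besselI (k + 2).natAbs β) / 4) =
      besselI 0 β ^ (V - 1) * ((besselI 0 β + besselI 2 β) / 2) +
        2 * (besselI 1 β ^ (V - 1) * ((3 * besselI 1 β + besselI 3 β) / 4)) +
        2 * (besselI 2 β ^ (V - 1) * ((besselI 0 β + 2 * besselI 2 β + besselI 4 β) / 4)) := by
  simp only [centralCharges]
  norm_num
  ring

end Summit.Ventures.LatticeQCDFlow.Scoring
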